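import Literature.NumberTheory.EllipticCurves.BhargavaShankarSolubleOrbits
import HarnessLib

/-!
# Pointed binary quartic forms: normal forms with a marked point, their uniqueness, and transport
# of points under the twisted action (any field with `2 ≠ 0`, `3 ≠ 0`)

Topic `Literature/NumberTheory/EllipticCurves`; companion of `BhargavaShankarSolubleOrbits.lean`
(normal forms of `K`-soluble quartics in characteristic `0`) and `BinaryQuarticStabilizer.lean`
(the twisted action `BinaryQuartic.twist γ f = (det γ)⁻² f((x,y)γ)`).

For the counting proof that every binary quartic form with nonzero discriminant over a finite
field `𝔽_q` (`q` prime to `6`) is `𝔽_q`-soluble — whence "`p ∤ Δ(f)` implies `f` is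
`ℚ_p`-soluble", the input of Bhargava–Shankar's uniformity estimate (Prop. 5.13 of the held arXiv
text `arXiv:1006.1002v2`, Prop. 3.18 of the published version: "if the discriminant of
`f ∈ V_{ℤ_p}` is prime to `p`, then `f` is `ℚ_p`-soluble (see [Cremona])") — one needs the
structure of the set of *pointed* forms `(f; v, z)`, `z² = f(v)`, `v ∈ K² ∖ 0`, under `GL₂(K)`,
over fields of positive characteristic. This file provides it over any field with `2 ≠ 0`,
`3 ≠ 0` (the characteristic-`0` file `BhargavaShankarSolubleOrbits.lean` tracks in addition the
image of the point in `E_{I,J}`, which is not needed here):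

* `exists_normalizer` — **existence**: if `z² = f(v)`, `z ≠ 0`, there is `γ ∈ GL₂(K)` with first
  row `v`, `det γ = z`, and `γ · f` monic with no `x³y` term (`a = 1`, `b = 0`);
* `normalizer_unique` — **uniqueness**: such a `γ` is unique, and so is the normal form: if
  `γ · f` and `γ' · f` are both monic with `b = 0`, `γ, γ'` have the same first row and the same
  determinant, then `γ = γ'` (the only matrices fixing the marked point `(1, 0, 1)` are the shears
  `(1 0; r 1)`, which move `b` by `4r`);
* `exists_normalizer_root`, `normalizer_root_unique` — the same for a marked **root** `f(v) = 0`
  (`Δ(f) ≠ 0`): a unique `γ` with first row `v` carries `f` to the trivial quartic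
  `f_O = x³y − (I/3)xy³ − (J/27)y⁴` (`BinaryQuartic.trivialQuartic`);
* `mapTriple`, `image_mapTriple_pointTriples`, `ncard_pointTriples_twist`, `eval_twist_inv_row` —
  **transport of points**: `(v, z) ↦ (vγ, z det γ)` is a bijection from the solutions
  (`pointTriples`) of `z² = (γ · f)(v)` onto those of `z² = f(v)` (`v ≠ 0`).

## References

* M. Bhargava, A. Shankar, Ann. of Math. (2) 181 (2015) 191–242, proof of Prop. 5.13
  (arXiv:1006.1002v2 numbering) / Prop. 3.18 (published). [cite: BhargavaShankarAnnals2015, Prop. 5.13, proof (arXiv:1006.1002v2 numbering)]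
* J. E. Cremona, J. Symbolic Comput. 31 (2001), Prop. 4.1 (a quartic is soluble iff equivalent to
  one with square leading coefficient). [cite: Cremona2001, Prop. 4.1]

## Design

Points of `z² = f(x, y)` are kept as pairs `(v, z) ∈ K² × K` with `v ≠ 0` (no quotient by the
scaling `(v, z) ∼ (tv, t²z)`); "first row of `γ`" is `(γ 0 0, γ 0 1)`, and the marked point of a
triple `(γ · ⁻¹ f*, (γ₀₀, γ₀₁), det γ)` is the pull-back of the base point `(1, 0, 1)` of the
normal form `f*`.
-/

noncomputable section

open scoped Classical
open Matrix

namespace Literature.NumberTheory.EllipticCurves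

namespace BinaryQuartic

variable {K : Type*} [Field K]

/-! ## Matrices with prescribed first row; the first row of a product -/

/-- The first row of `δ = γ' γ⁻¹` is `(1, 0)` when `γ`, `γ'` have the same first row. [folklore] -/
theorem row_mul_inv_eq {γ γ' : Matrix (Fin 2) (Fin 2) K} (hγ : γ.det ≠ 0)
    (h0 : γ' 0 0 = γ 0 0) (h1 : γ' 0 1 = γ 0 1) :
    (γ' * γ⁻¹) 0 0 = 1 ∧ (γ' * γ⁻¹) 0 1 = 0 := by
  have hγu : IsUnit γ.det := isUnit_iff_ne_zero.mpr hγ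
  have h := Matrix.mul_nonsing_inv γ hγu
  have e00 := congrFun (congrFun h 0) 0
  have e01 := congrFun (congrFun h 0) 1
  simp only [Matrix.mul_apply, Fin.sum_univ_two, Matrix.one_apply_eq, Matrix.one_apply_ne, ne_eq,
    zero_ne_one, not_false_eq_true] at e00 e01
  constructor
  · simp only [Matrix.mul_apply, Fin.sum_univ_two, h0, h1]; exact e00
  · simp only [Matrix.mul_apply, Fin.sum_univ_two, h0, h1]; exact e01

/-- A matrix with first row `(1, 0)` is `(1 0; r s)`. [folklore] -/
theorem eq_of_row_eq_one_zero {δ : Matrix (Fin 2) (Fin 2) K} (h0 : δ 0 0 = 1) (h1 : δ 0 1 = 0) :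
    δ = !![1, 0; δ 1 0, δ 1 1] := by
  ext i j; fin_cases i <;> fin_cases j <;> simp [h0, h1]

/-! ## Transport of points under the twisted action -/

/-- The marked point pulls back: `(γ⁻¹ · g)` takes the value `(det γ)² · g(1, 0)` at the first row
of `γ`. [folklore] -/
theorem eval_twist_inv_row {γ : Matrix (Fin 2) (Fin 2) K} (hγ : γ.det ≠ 0) (g : BinaryQuartic K) :
    (twist γ⁻¹ g).eval (γ 0 0) (γ 0 1) = γ.det ^ 2 * g.eval 1 0 := by
  have hγu : IsUnit γ.det := isUnit_iff_ne_zero.mpr hγ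
  have h := Matrix.mul_nonsing_inv γ hγu
  have e00 := congrFun (congrFun h 0) 0
  have e01 := congrFun (congrFun h 0) 1
  simp only [Matrix.mul_apply, Fin.sum_univ_two, Matrix.one_apply_eq, Matrix.one_apply_ne, ne_eq,
    zero_ne_one, not_false_eq_true] at e00 e01
  rw [eval_twist, e00, e01, Matrix.det_nonsing_inv, Ring.inverse_eq_inv']
  field_simp

/-- **Transport of points**: if `g = γ · f` then `z² = g(v)` iff `(z det γ)² = f(vγ)`. [folklore] -/
theorem sq_eq_eval_twist_iff {γ : Matrix (Fin 2) (Fin 2) K} (hγ : γ.det ≠ 0) (f : BinaryQuartic K)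
    (x y z : K) :
    z ^ 2 = (twist γ f).eval x y ↔
      (z * γ.det) ^ 2 = f.eval (x * γ 0 0 + y * γ 1 0) (x * γ 0 1 + y * γ 1 1) := by
  rw [eval_twist]
  have h2 : (γ.det ^ 2 : K) ≠ 0 := pow_ne_zero 2 hγ
  constructor
  · intro h; rw [mul_pow, h]; field_simp
  · intro h; field_simp; linear_combination h

/-- A nonzero row vector stays nonzero under an invertible matrix. [folklore] -/
theorem row_ne_zero_of_det_ne_zero {γ : Matrix (Fin 2) (Fin 2) K} (hγ : γ.det ≠ 0) {x y : K}
    (hxy : x ≠ 0 ∨ y ≠ 0) : x * γ 0 0 + y * γ 1 0 ≠ 0 ∨ x * γ 0 1 + y * γ 1 1 ≠ 0 := by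
  by_contra h
  push Not at h
  obtain ⟨h0, h1⟩ := h
  apply hγ
  rw [Matrix.det_fin_two]
  rcases hxy with hx | hy
  · have : x * (γ 0 0 * γ 1 1 - γ 0 1 * γ 1 0) = 0 := by
      linear_combination γ 1 1 * h0 - γ 1 0 * h1
    exact (mul_eq_zero.mp this).resolve_left hx
  · have : y * (γ 0 0 * γ 1 1 - γ 0 1 * γ 1 0) = 0 := by
      linear_combination -(γ 0 1) * h0 + γ 0 0 * h1
    exact (mul_eq_zero.mp this).resolve_left hy

/-- The set of solutions `(v, z)`, `v ∈ K² ∖ 0`, of `z² = f(v)` ("points of `C_f` before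
projectivisation"). [folklore] -/
def pointTriples (f : BinaryQuartic K) : Set (K × K × K) :=
  {t | (t.1 ≠ 0 ∨ t.2.1 ≠ 0) ∧ t.2.2 ^ 2 = f.eval t.1 t.2.1}

/-- Membership in `pointTriples` (unfolding). [folklore] -/
theorem mem_pointTriples_iff (f : BinaryQuartic K) (t : K × K × K) :
    t ∈ pointTriples f ↔ (t.1 ≠ 0 ∨ t.2.1 ≠ 0) ∧ t.2.2 ^ 2 = f.eval t.1 t.2.1 := Iff.rfl

/-- The transport map `(v, z) ↦ (vγ, z det γ)` on triples. [folklore] -/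
def mapTriple (γ : Matrix (Fin 2) (Fin 2) K) (t : K × K × K) : K × K × K :=
  (t.1 * γ 0 0 + t.2.1 * γ 1 0, t.1 * γ 0 1 + t.2.1 * γ 1 1, t.2.2 * γ.det)

/-- `mapTriple` is multiplicative: `mapTriple (γ₁γ₂) = mapTriple γ₂ ∘ mapTriple γ₁` (row vectors act
on the right). [folklore] -/
theorem mapTriple_mul (γ₁ γ₂ : Matrix (Fin 2) (Fin 2) K) (t : K × K × K) :
    mapTriple (γ₁ * γ₂) t = mapTriple γ₂ (mapTriple γ₁ t) := by
  simp only [mapTriple, Matrix.mul_apply, Fin.sum_univ_two, Matrix.det_mul, Prod.mk.injEq]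
  exact ⟨by ring, by ring, by ring⟩

/-- `mapTriple 1 = id`. [folklore] -/
@[simp] theorem mapTriple_one (t : K × K × K) : mapTriple (1 : Matrix (Fin 2) (Fin 2) K) t = t := by
  obtain ⟨x, y, z⟩ := t
  simp [mapTriple]

/-- `mapTriple γ⁻¹` inverts `mapTriple γ`. [folklore] -/
theorem mapTriple_inv_mapTriple {γ : Matrix (Fin 2) (Fin 2) K} (hγ : γ.det ≠ 0) (t : K × K × K) :
    mapTriple γ⁻¹ (mapTriple γ t) = t := by
  rw [← mapTriple_mul, Matrix.mul_nonsing_inv γ (isUnit_iff_ne_zero.mpr hγ), mapTriple_one]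

/-- `mapTriple γ` inverts `mapTriple γ⁻¹`. [folklore] -/
theorem mapTriple_mapTriple_inv {γ : Matrix (Fin 2) (Fin 2) K} (hγ : γ.det ≠ 0) (t : K × K × K) :
    mapTriple γ (mapTriple γ⁻¹ t) = t := by
  rw [← mapTriple_mul, Matrix.nonsing_inv_mul γ (isUnit_iff_ne_zero.mpr hγ), mapTriple_one]

/-- `mapTriple γ` is injective for invertible `γ`. [folklore] -/
theorem mapTriple_injective {γ : Matrix (Fin 2) (Fin 2) K} (hγ : γ.det ≠ 0) :
    Function.Injective (mapTriple γ) := fun t t' h ↦ by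
  rw [← mapTriple_inv_mapTriple hγ t, h, mapTriple_inv_mapTriple hγ t']

/-- `mapTriple γ` carries the solutions of `z² = (γ · f)(v)` into those of `z² = f(v)`. [folklore] -/
theorem mapTriple_mem_pointTriples {γ : Matrix (Fin 2) (Fin 2) K} (hγ : γ.det ≠ 0)
    (f : BinaryQuartic K) {t : K × K × K} (ht : t ∈ pointTriples (twist γ f)) :
    mapTriple γ t ∈ pointTriples f :=
  ⟨row_ne_zero_of_det_ne_zero hγ ht.1, (sq_eq_eval_twist_iff hγ f _ _ _).mp ht.2⟩

/-- **Transport of points**: `mapTriple γ` maps `pointTriples (γ · f)` onto `pointTriples f`.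
[folklore] -/
theorem image_mapTriple_pointTriples {γ : Matrix (Fin 2) (Fin 2) K} (hγ : γ.det ≠ 0)
    (f : BinaryQuartic K) : mapTriple γ '' pointTriples (twist γ f) = pointTriples f := by
  have hγ' : γ⁻¹.det ≠ 0 := by
    rw [Matrix.det_nonsing_inv, Ring.inverse_eq_inv']; exact inv_ne_zero hγ
  ext t
  constructor
  · rintro ⟨t', ht', rfl⟩
    exact mapTriple_mem_pointTriples hγ f ht'
  · intro ht
    refine ⟨mapTriple γ⁻¹ t, ?_, mapTriple_mapTriple_inv hγ t⟩
    have h := mapTriple_mem_pointTriples hγ' (twist γ f) (t := t) (by rwa [twist_inv_twist hγ])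
    exact h

/-- **Equivalent forms have equinumerous solution sets** `{(v, z) : z² = f(v), v ≠ 0}`. [folklore] -/
theorem ncard_pointTriples_twist {γ : Matrix (Fin 2) (Fin 2) K} (hγ : γ.det ≠ 0) (f : BinaryQuartic K) :
    (pointTriples (twist γ f)).ncard = (pointTriples f).ncard := by
  rw [← image_mapTriple_pointTriples hγ f, Set.ncard_image_of_injective _ (mapTriple_injective hγ)]

/-! ## Normal form with a marked point `z ≠ 0`: existence and uniqueness -/

/-- **Existence of the normalizer**: if `z² = f(v)` with `v ≠ 0`, `z ≠ 0`, some `γ ∈ GL₂(K)` with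
first row `v` and `det γ = z` makes `γ · f` monic with no `x³y`-term (`2 ≠ 0`). Then the marked
point `(v, z)` is the pull-back `((1,0)γ, det γ)` of the base point `(1, 0, 1)` of `γ · f`.
[cite: Cremona2001, Prop. 4.1] -/
theorem exists_normalizer (h2 : (2 : K) ≠ 0) (f : BinaryQuartic K) {x y z : K} (hxy : x ≠ 0 ∨ y ≠ 0)
    (hz : z ^ 2 = f.eval x y) (hz0 : z ≠ 0) :
    ∃ γ : Matrix (Fin 2) (Fin 2) K, γ 0 0 = x ∧ γ 0 1 = y ∧ γ.det = z ∧
      (twist γ f).a = 1 ∧ (twist γ f).b = 0 := by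
  have h4 : (4 : K) ≠ 0 := by
    rw [show (4 : K) = 2 * 2 by norm_num]; exact mul_ne_zero h2 h2
  obtain ⟨γ₁, h00, h01, hdet⟩ := exists_matrix_row_det x y z hxy
  have hγ₁ : γ₁.det ≠ 0 := hdet ▸ hz0
  set f₁ := twist γ₁ f with hf₁
  have ha₁ : f₁.a = 1 := by
    rw [hf₁, twist_a_eq, h00, h01, hdet, ← hz, inv_mul_cancel₀ (pow_ne_zero 2 hz0)]
  set t := -f₁.b / 4 with ht
  refine ⟨!![1, 0; t, 1] * γ₁, ?_, ?_, ?_, ?_, ?_⟩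
  · simp [Matrix.mul_apply, Fin.sum_univ_two, h00]
  · simp [Matrix.mul_apply, Fin.sum_univ_two, h01]
  · rw [Matrix.det_mul, hdet]; simp [Matrix.det_fin_two]
  · rw [twist_mul, ← hf₁, twist_lowerShear]; exact ha₁
  · rw [twist_mul, ← hf₁, twist_lowerShear]
    show 4 * f₁.a * t + f₁.b = 0
    rw [ha₁, ht]; field_simp; ring

/-- **Uniqueness of the normalizer**: two matrices with the same first row and the same determinant
that both carry `f` to a monic form with `b = 0` are equal (`2 ≠ 0`): their quotient fixes the base
point, hence is a shear `(1 0; r 1)`, which changes `b` by `4r`. [folklore] -/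
theorem normalizer_unique (h2 : (2 : K) ≠ 0) (f : BinaryQuartic K) {γ γ' : Matrix (Fin 2) (Fin 2) K}
    (hγ : γ.det ≠ 0) (h0 : γ' 0 0 = γ 0 0) (h1 : γ' 0 1 = γ 0 1) (hdet : γ'.det = γ.det)
    (ha : (twist γ f).a = 1) (hb : (twist γ f).b = 0) (hb' : (twist γ' f).b = 0) : γ' = γ := by
  have h4 : (4 : K) ≠ 0 := by
    rw [show (4 : K) = 2 * 2 by norm_num]; exact mul_ne_zero h2 h2
  have hγu : IsUnit γ.det := isUnit_iff_ne_zero.mpr hγ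
  obtain ⟨d00, d01⟩ := row_mul_inv_eq hγ h0 h1
  set δ := γ' * γ⁻¹ with hδ
  have hdetδ : δ.det = 1 := by
    rw [hδ, Matrix.det_mul, Matrix.det_nonsing_inv, Ring.inverse_eq_inv', hdet, mul_inv_cancel₀ hγ]
  have hδ' : δ = !![1, 0; δ 1 0, 1] := by
    have h := eq_of_row_eq_one_zero d00 d01
    have h11 : δ 1 1 = 1 := by
      rw [h] at hdetδ; simpa [Matrix.det_fin_two] using hdetδ
    rw [h11] at h; exact h
  have hγ'δ : γ' = δ * γ := by
    rw [hδ, Matrix.mul_assoc, Matrix.nonsing_inv_mul γ hγu, Matrix.mul_one]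
  have htw : twist γ' f = twist !![1, 0; δ 1 0, 1] (twist γ f) := by
    rw [hγ'δ, twist_mul, ← hδ']
  rw [htw, twist_lowerShear] at hb'
  change 4 * (twist γ f).a * δ 1 0 + (twist γ f).b = 0 at hb'
  rw [ha, hb, add_zero, mul_one] at hb'
  have hr : δ 1 0 = 0 := (mul_eq_zero.mp hb').resolve_left h4
  rw [hγ'δ, hδ', hr]
  ext i j; fin_cases i <;> fin_cases j <;> simp [Matrix.mul_apply, Fin.sum_univ_two]

/-! ## Normal form with a marked root: existence and uniqueness -/

/-- A form `(0, 1, 0, d, e)` is `f_O` for its invariants (`3 ≠ 0`; characteristic-free version of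
`eq_trivialQuartic_of_abc`). [folklore] -/
theorem eq_trivialQuartic_of_abc_of_ne (h3 : (3 : K) ≠ 0) {f : BinaryQuartic K} (ha : f.a = 0)
    (hb : f.b = 1) (hc : f.c = 0) : f = trivialQuartic f.I f.J := by
  have h27 : (27 : K) ≠ 0 := by
    rw [show (27 : K) = 3 * 3 * 3 by norm_num]; exact mul_ne_zero (mul_ne_zero h3 h3) h3
  ext
  · simp [trivialQuartic, ha]
  · simp [trivialQuartic, hb]
  · simp [trivialQuartic, hc]
  · simp only [trivialQuartic, BinaryQuartic.I, ha, hb, hc]; field_simp; ring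
  · simp only [trivialQuartic, BinaryQuartic.J, ha, hb, hc]; field_simp; ring

/-- If `a = b = 0` then `Δ = 0`. [folklore] -/
private theorem disc_eq_zero_of_ab {f : BinaryQuartic K} (ha : f.a = 0) (hb : f.b = 0) : f.disc = 0 := by
  simp [disc, ha, hb]

/-- **Existence of the root normalizer**: if `f(v) = 0`, `v ≠ 0`, `Δ(f) ≠ 0`, some `γ ∈ GL₂(K)`
with first row `v` carries `f` to `f_O = x³y − (I/3)xy³ − (J/27)y⁴` (`3 ≠ 0`).
[cite: BhargavaShankarAnnals2015, Lemma 5.10 (arXiv:1006.1002v2 numbering)] -/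
theorem exists_normalizer_root (h3 : (3 : K) ≠ 0) {f : BinaryQuartic K} (hΔ : f.disc ≠ 0)
    {x y : K} (hxy : x ≠ 0 ∨ y ≠ 0) (h0 : f.eval x y = 0) :
    ∃ γ : Matrix (Fin 2) (Fin 2) K, γ 0 0 = x ∧ γ 0 1 = y ∧ γ.det ≠ 0 ∧
      twist γ f = trivialQuartic f.I f.J := by
  obtain ⟨γ₁, h00, h01, hdet⟩ := exists_matrix_row_det x y 1 hxy
  have hγ₁ : γ₁.det ≠ 0 := by rw [hdet]; exact one_ne_zero
  set f₁ := twist γ₁ f with hf₁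
  have ha₁ : f₁.a = 0 := by rw [hf₁, twist_a_eq, h00, h01, h0, mul_zero]
  have hΔ₁ : f₁.disc ≠ 0 := by rwa [hf₁, disc_twist h3 hγ₁]
  have hb₁ : f₁.b ≠ 0 := fun hb ↦ hΔ₁ (disc_eq_zero_of_ab ha₁ hb)
  set γ₃ : Matrix (Fin 2) (Fin 2) K := !![1, 0; 0, f₁.b] with hγ₃
  have hdet₃ : γ₃.det = f₁.b := by simp [hγ₃, Matrix.det_fin_two]
  have hγ₃' : γ₃.det ≠ 0 := by rwa [hdet₃]
  set f₃ := twist γ₃ f₁ with hf₃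
  have hf₃' : f₃ = ⟨0, 1, f₁.c, f₁.d * f₁.b, f₁.e * f₁.b ^ 2⟩ := by
    rw [hf₃, twist, hdet₃]
    ext <;> simp [hγ₃, subst, ha₁] <;> field_simp
  set t := -f₁.c / 3 with ht
  set γ₄ : Matrix (Fin 2) (Fin 2) K := !![1, 0; t, 1] with hγ₄
  have hdet₄ : γ₄.det = 1 := by simp [hγ₄, Matrix.det_fin_two]
  have hγ₄' : γ₄.det ≠ 0 := by rw [hdet₄]; exact one_ne_zero
  set f₄ := twist γ₄ f₃ with hf₄
  have hf₄' : f₄ = ⟨f₃.a, 4 * f₃.a * t + f₃.b, 6 * f₃.a * t ^ 2 + 3 * f₃.b * t + f₃.c,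
      4 * f₃.a * t ^ 3 + 3 * f₃.b * t ^ 2 + 2 * f₃.c * t + f₃.d,
      f₃.a * t ^ 4 + f₃.b * t ^ 3 + f₃.c * t ^ 2 + f₃.d * t + f₃.e⟩ := by
    rw [hf₄, hγ₄, twist_lowerShear]
  have ha₄ : f₄.a = 0 := by rw [hf₄', hf₃']
  have hb₄ : f₄.b = 1 := by rw [hf₄', hf₃']; ring
  have hc₄ : f₄.c = 0 := by
    rw [hf₄', hf₃']
    show 6 * 0 * t ^ 2 + 3 * 1 * t + f₁.c = 0
    rw [ht]; field_simp; ring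
  have hI₄ : f₄.I = f.I := by
    rw [hf₄, I_twist hγ₄', hf₃, I_twist hγ₃', hf₁, I_twist hγ₁]
  have hJ₄ : f₄.J = f.J := by
    rw [hf₄, J_twist hγ₄', hf₃, J_twist hγ₃', hf₁, J_twist hγ₁]
  refine ⟨γ₄ * γ₃ * γ₁, ?_, ?_, ?_, ?_⟩
  · simp [hγ₄, hγ₃, Matrix.mul_apply, Fin.sum_univ_two, h00]
  · simp [hγ₄, hγ₃, Matrix.mul_apply, Fin.sum_univ_two, h01]
  · rw [Matrix.det_mul, Matrix.det_mul]; exact mul_ne_zero (mul_ne_zero hγ₄' hγ₃') hγ₁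
  · rw [twist_mul, twist_mul, ← hf₁, ← hf₃, ← hf₄, eq_trivialQuartic_of_abc_of_ne h3 ha₄ hb₄ hc₄,
      hI₄, hJ₄]

/-- **Uniqueness of the root normalizer**: a matrix with first row `(1, 0)` fixing `f_O` is the
identity (`3 ≠ 0`): it is `(1 0; r s)`, and `(1 0; r s) · f_O` has `b = 1/s`, `c = 3r/s`. [folklore] -/
theorem eq_one_of_twist_trivialQuartic_eq (h3 : (3 : K) ≠ 0) {I J : K} {δ : Matrix (Fin 2) (Fin 2) K}
    (hδ : δ.det ≠ 0) (d00 : δ 0 0 = 1) (d01 : δ 0 1 = 0)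
    (h : twist δ (trivialQuartic I J) = trivialQuartic I J) : δ = 1 := by
  have hshape := eq_of_row_eq_one_zero d00 d01
  have hs : δ 1 1 ≠ 0 := by
    rw [hshape] at hδ; simpa [Matrix.det_fin_two] using hδ
  have hdet : δ.det = δ 1 1 := by rw [hshape]; simp [Matrix.det_fin_two]
  have hb := congrArg BinaryQuartic.b h
  have hc := congrArg BinaryQuartic.c h
  rw [twist, smul_b, hdet] at hb
  rw [twist, smul_c, hdet] at hc
  conv_lhs at hb => rw [hshape]
  conv_lhs at hc => rw [hshape]
  simp only [subst, trivialQuartic, Matrix.of_apply, Matrix.cons_val', Matrix.cons_val_zero,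
    Matrix.cons_val_one, Matrix.cons_val_fin_one, Matrix.empty_val'] at hb hc
  have hs1 : δ 1 1 = 1 := by
    field_simp at hb
    have h3' : (3 : K) * (δ 1 1 * (δ 1 1 - 1)) = 0 := by linear_combination -hb
    rcases mul_eq_zero.mp h3' with h' | h'
    · exact absurd h' h3
    · rcases mul_eq_zero.mp h' with h'' | h''
      · exact absurd h'' hs
      · linear_combination h''
  have hr : δ 1 0 = 0 := by
    rw [hs1] at hc
    have : (3 : K) * δ 1 0 = 0 := by
      have hc' := hc
      simp only [one_pow, inv_one, one_mul, mul_one, mul_zero, zero_mul, add_zero, zero_add,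
        zero_pow two_ne_zero] at hc'
      linear_combination hc'
    exact (mul_eq_zero.mp this).resolve_left h3
  rw [hshape, hs1, hr]
  ext i j; fin_cases i <;> fin_cases j <;> simp

/-- **Uniqueness for marked roots**: two matrices with the same first row carrying `f` to `f_O`
are equal (`3 ≠ 0`). [folklore] -/
theorem normalizer_root_unique (h3 : (3 : K) ≠ 0) (f : BinaryQuartic K) {I J : K}
    {γ γ' : Matrix (Fin 2) (Fin 2) K} (hγ : γ.det ≠ 0) (hγ' : γ'.det ≠ 0)
    (h0 : γ' 0 0 = γ 0 0) (h1 : γ' 0 1 = γ 0 1)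
    (h : twist γ f = trivialQuartic I J) (h' : twist γ' f = trivialQuartic I J) : γ' = γ := by
  have hγu : IsUnit γ.det := isUnit_iff_ne_zero.mpr hγ
  obtain ⟨d00, d01⟩ := row_mul_inv_eq hγ h0 h1
  set δ := γ' * γ⁻¹ with hδ
  have hdetδ : δ.det ≠ 0 := by
    rw [hδ, Matrix.det_mul, Matrix.det_nonsing_inv, Ring.inverse_eq_inv']
    exact mul_ne_zero hγ' (inv_ne_zero hγ)
  have hγ'δ : γ' = δ * γ := by
    rw [hδ, Matrix.mul_assoc, Matrix.nonsing_inv_mul γ hγu, Matrix.mul_one]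
  have hfix : twist δ (trivialQuartic I J) = trivialQuartic I J := by
    rw [← h, ← twist_mul, ← hγ'δ, h', h]
  rw [hγ'δ, eq_one_of_twist_trivialQuartic_eq h3 hdetδ d00 d01 hfix, Matrix.one_mul]

end BinaryQuartic

end Literature.NumberTheory.EllipticCurves

end
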